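import Literature.NumberTheory.LFunctions.NoExceptionalZeroUpTo
import Literature.NumberTheory.LFunctions.KadiriDirichletExceptionalZero
import HarnessLib

/-!
# An explicit zero-free region WITHOUT exceptional zero for all characters to moduli `q ≤ Q`,
# from an at-most-one-zero theorem (McCurley 1984 / Kadiri 2018) and a no-exceptional-zero table

Topic `Literature/NumberTheory/LFunctions`; namespace `Literature.NumberTheory.LFunctions`. Two
definitions with parameters (`AtMostOneZeroInRegion R₀ M₀`, `ZeroFreeRegionUpTo Q R M₀`), ONE
named fact AS PRINTED (`McCurley1984_theorem1`, D-0014, not discharged), and THEOREMS.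

## What the sources print

* K. S. McCurley, *Explicit zero-free regions for Dirichlet L-functions*, J. Number Theory 19
  (1984) 7–32, **Theorem 1** (held copy, p. 8): "Let `M = max{k, k|t|, 10}` and
  `R = 9.645908801`. Then `𝓛_k(s)` [`= ∏_{χ mod k} L(s, χ)`] has at most a single zero in the
  region `{s : σ ⩾ 1 − 1/(R log M)}`. The only possible zero in this region is a simple real zero
  arising from an L-function formed with a real non-principal character modulo `k`." And (ibid.):
  "If a real zero `β` of `𝓛_k(s)` exists for which `β > 1 − 1/(R log k)`, then we shall refer to
  `β` as an exceptional zero, and `k` as an exceptional modulus. Nonexceptional moduli are of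
  particular interest since for these `k` Theorem 1 allows us to prove sharp explicit numerical
  bounds for the Chebyshev functions `ψ(x; k, l)` and `θ(x; k, l)`."
  ERRATUM OF RECORD (2026-08-28, littype-FP2-1 g17): the relation in the displayed region of
  Theorem 1 is `⩾` — the region is CLOSED. Earlier versions of this docstring quoted `σ >` after
  the OCR text layer of the held scan (`{s : o > 1 - l/(R log M)}`), which cannot distinguish `>`
  from `⩾`; the page IMAGE of p. 8 (CCITT strips of the held pdf, decoded and rendered 2026-08-28)
  shows `{s : σ ⩾ 1 − 1/(R log M)}` unambiguously (the same glyph as in `x ⩾ 17` of display (3) on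
  the same page, versus the plain `>` of "the case `k > 1`" and of "`β > 1 − 1/(R log k)`" in the
  exceptional-zero definition, which IS strict in print). So are the restatements in print:
  Kadiri, Mathematika 64 (2018) Thm 2.2 and Thorner–Zaman, Forum Math. 36 (2024) Lemma 2.3 both
  give McCurley's region as `σ ≥ 1 − 1/(R log M)`. The tree's `McCurley1984_theorem1` below keeps
  the OPEN region (strictly WEAKER than print, hence safe; all its consumers stand); the statement
  AS PRINTED is `McCurley1984_theorem1_closed` (last section of this file), from which the open
  form follows (`McCurley1984_theorem1_of_closed`).
* H. Kadiri, *An explicit zero-free region for the Dirichlet L-functions*, unrefereed preprint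
  arXiv:math/0510570 (2005), Theorem 1.1: the same shape with the CLOSED region
  `σ ≥ 1 − 1/(R₀ log max(q, q|t|))`, `R₀ = 6.3970`, all `q` (her Lille thesis, 2002: `6.4355`);
  typed in the tree in `∃ R₀ ≥ 1` form only (`Kadiri2018.dirichlet_atMostOneZero`,
  `KadiriDirichletExceptionalZero.lean`). CAUTION (erratum recorded 2026-08-26, ls-lit-r3 g2): the
  REFEREED paper H. Kadiri, *Explicit zero-free regions for Dirichlet L-functions*, Mathematika 64
  (2018) 445–474 (not held; acq-10983) is a SMALL-MODULUS theorem — `R = 5.60` and NO zero at all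
  for `3 ≤ q ≤ 400 000` (zbMATH Zbl 1412.11096; Bordignon, arXiv:1809.05226 p. 3; Lu–Zaman–Zhao
  arXiv:2602.03626 p. 1; BMOR 2018 Prop. 4.34) — it contains no all-`q` constant; the all-`q`
  at-most-one-zero theorem of refereed record is McCurley's (above), and the section
  "The converse bridge" at the end of this file derives the `∃`-form Kadiri fact from it.
* Bennett–Martin–O'Bryant–Rechnitzer, Illinois J. Math. 62 (2018), Definition 6.1 and the proof
  of Proposition 6.18: McCurley's theorem ("Hypothesis Z₁(9.645908801)") plus the absence of an
  exceptional zero give a zero-free region without exception, hence `ψ(x; q, a)` bounds "with a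
  much weaker condition on the size of `x`"; "this is the case, via Platt, for `10⁵ < q ≤ 4·10⁵`".

## Contents

* `AtMostOneZeroInRegion R₀ M₀` — the at-most-one-zero statement with constant `R₀` and floor
  `M₀` in `M = max(q, q|t|, M₀)`, open region `σ > 1 − 1/(R₀ log M)`, all moduli `q ≥ 3`, pairs
  `(χ, s)` with `s ≠ 1` (Mathlib's `LFunction χ₀ 1` is a junk value at the pole); the unique zero
  is real and its character is real and non-principal. Simplicity is NOT rendered (weaker than
  print, deliberately — as for the tree's Kadiri fact). `AtMostOneZeroInRegion.mono`: monotone in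
  `(R₀, M₀)` (a larger constant or floor is a smaller region).
* `McCurley1984_theorem1 := AtMostOneZeroInRegion 9.645908801 10` — **named fact, OPEN-region
  rendering** (weaker than print, see the erratum above; restricted to `k ≥ 3`: for `k = 1, 2`
  every character is principal and the statement is one about `ζ`, not needed here).
* `AtMostOneZeroInClosedRegion R₀ M₀`, `McCurley1984_theorem1_closed := AtMostOneZeroInClosedRegion
  9.645908801 10` — **named fact, AS PRINTED** (closed region `σ ⩾ 1 − 1/(R log M)`; same scope
  and rendering conventions otherwise), with `AtMostOneZeroInClosedRegion.toOpen/mono/real_of_zero`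
  and `McCurley1984_theorem1_of_closed : McCurley1984_theorem1_closed → McCurley1984_theorem1`
  (last section).
* `atMostOneZeroInRegion_of_kadiri` — the tree's `∃`-form Kadiri fact gives
  `∃ R₀ ≥ 1, ∀ M₀ ≤ 3, AtMostOneZeroInRegion R₀ M₀` (closed region ⊇ open region; `M₀ ≤ 3 ≤ q`).
* Conversely `Kadiri2018.dirichlet_atMostOneZero_of_atMostOneZeroInRegion` (`R₀ > 0`, any `M₀`,
  witness `R' = 1 + R₀ + R₀ log max(M₀, 3)`) and
  `Kadiri2018.dirichlet_atMostOneZero_of_mccurley : McCurley1984_theorem1 → Kadiri2018.dirichlet_atMostOneZero`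
  — the `∃`-form fact is a corollary of McCurley's refereed all-`q` theorem.
* `ZeroFreeRegionUpTo Q R M₀` — for every `3 ≤ q ≤ Q`, every `χ` mod `q` and every `s ≠ 1` with
  `σ > 1 − 1/(R log max(q, q|t|, M₀))`: `L(s, χ) ≠ 0`. Antitone in `Q`, monotone in `(R, M₀)`.
* **Main theorem** `zeroFreeRegionUpTo_of_noExceptionalZeroUpTo`:
  `AtMostOneZeroInRegion R₀ M₀ → NoExceptionalZeroUpTo Q c₀ → ZeroFreeRegionUpTo Q R M₀` for every
  `R ≥ max(R₀, 1/c₀, 1)` (a zero in the `R`-region lies in the `R₀`-region, so it is real, `σ`,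
  from a quadratic `χ ≠ χ₀`; at `t = 0` the region reads `σ > 1 − 1/(R log max(q, M₀)) ≥ 1 − c₀/log q`,
  and `σ > 0` since `R log 3 ≥ 1`; now `NoExceptionalZeroUpTo.lfunction_ne_zero`).
* the converse bookkeeping `noExceptionalZeroUpTo_of_zeroFreeRegionUpTo` (`M₀ ≤ 3`, any `c < 1/R`),
  the `∃`-form through Kadiri (`exists_zeroFreeRegionUpTo_of_kadiri`), and the instance of record
  of the printed range, conditional on the two named facts:
  `zeroFreeRegionUpTo_platt_mccurley : platt2016_theorem71 → McCurley1984_theorem1 →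
  ZeroFreeRegionUpTo 400000 9.645908801 10` — for `3 ≤ q ≤ 4·10⁵` NO Dirichlet `L`-function mod `q`
  vanishes at any `s ≠ 1` with `Re s > 1 − 1/(9.645908801 log max(q, q|Im s|, 10))`.

What is NOT here: a discharge of McCurley's theorem (size L explicit analysis), Kadiri's
small-modulus constant `5.60` (`q ≤ 4·10⁵`, Mathematika 2018 — since 2026-08-28 the named fact
`kadiri2018_theorem11` of `CertifiedRangeDirichletZeroFreeRegion.lean`, typed from the accepted
text arXiv:math/0510570v2), and the `ψ(x; q, a)` consumers.

## References

* K. S. McCurley, J. Number Theory 19 (1984) 7–32, Theorem 1. [McCurley1984ZFR]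
* H. Kadiri, Mathematika 64 (2018) 445–474, Theorem 1.1 (`3 ≤ q ≤ 4·10⁵`, `R = 5.60`);
  zbMATH review Zbl 1412.11096. [Kadiri2018]
* H. Kadiri, arXiv:math/0510570 (2005), Theorem 1.1 (all `q`, `R₀ = 6.3970`, unrefereed).
* M. A. Bennett, G. Martin, K. O'Bryant, A. Rechnitzer, Illinois J. Math. 62 (2018) 427–532,
  Definition 6.1, Propositions 4.34 and 6.18. [BennettMartinOBryantRechnitzer2018]
* D. J. Platt, Math. Comp. 85 (2016) 3009–3027, Theorem 7.1. [Platt2016GRH]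
-/

noncomputable section

open Complex

namespace Literature.NumberTheory.LFunctions

/-! ### The at-most-one-zero statement with parameters -/

/-- **At most one zero of `∏_{χ mod q} L(s, χ)` in the region `σ > 1 − 1/(R₀ log max(q, q|t|, M₀))`,
real and from a real non-principal character** — the SHAPE of McCurley's Theorem 1
(`R₀ = 9.645908801`, `M₀ = 10`) and of Kadiri's Theorem 1.1 (`M₀ ≤ 3`, i.e. `max(q, q|t|)`), for all
moduli `q ≥ 3`, rendered on pairs: two zeros `(χ₁, s₁)`, `(χ₂, s₂)` in the region (`sᵢ ≠ 1`, to keep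
Mathlib's finite junk value of the principal `L`-function at its pole out of the statement)
coincide as pairs, the zero is real (`Im s₁ = 0`) and `χ₁ ≠ χ₀`, `χ₁² = χ₀`. Simplicity of the
zero is not rendered. [cite: McCurley1984ZFR, Theorem 1] -/
def AtMostOneZeroInRegion (R₀ M₀ : ℝ) : Prop :=
  ∀ (q : ℕ) [NeZero q], 3 ≤ q →
    ∀ (χ₁ χ₂ : DirichletCharacter ℂ q) (s₁ s₂ : ℂ), s₁ ≠ 1 → s₂ ≠ 1 →
      1 - 1 / (R₀ * Real.log (max (max (q : ℝ) ((q : ℝ) * |s₁.im|)) M₀)) < s₁.re →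
      1 - 1 / (R₀ * Real.log (max (max (q : ℝ) ((q : ℝ) * |s₂.im|)) M₀)) < s₂.re →
      χ₁.LFunction s₁ = 0 → χ₂.LFunction s₂ = 0 →
      (χ₁ = χ₂ ∧ s₁ = s₂) ∧ s₁.im = 0 ∧ χ₁ ≠ 1 ∧ χ₁ ^ 2 = 1

/-- **McCurley 1984, Theorem 1, OPEN-REGION rendering (p. 8 prints: "Let `M = max{k, k|t|, 10}` and
`R = 9.645908801`. Then `𝓛_k(s)` has at most a single zero in the region
`{s : σ ⩾ 1 − 1/(R log M)}`. The only possible zero in this region is a simple real zero arising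
from an L-function formed with a real non-principal character modulo `k`.")** Here
`𝓛_k(s) = ∏_{χ mod k} L(s, χ)` (op. cit. (1)). Rendered as `AtMostOneZeroInRegion 9.645908801 10`:
the OPEN region `σ > 1 − 1/(R log M)` (the print has the CLOSED region `σ ⩾ …` — see the module
docstring's erratum of record and `McCurley1984_theorem1_closed` for the statement as printed, which
implies this one: `McCurley1984_theorem1_of_closed`), moduli `k ≥ 3` only (for `k = 1, 2` the
statement concerns `ζ` alone), pairs `(χ, s)` with `s ≠ 1`, simplicity dropped — weaker than print
on all three counts. Proof: de la Vallée-Poussin's method with Stechkin's device and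
Rosser–Schoenfeld's constant, 26 pp. of explicit estimates; not discharged here (size L).
[cite: McCurley1984ZFR, Theorem 1] -/
def McCurley1984_theorem1 : Prop :=
  AtMostOneZeroInRegion 9.645908801 10

/-- The quantity `M = max(q, q|t|, M₀)` is at least `q ≥ 3`, so `log M > 1 > 0`. [folklore] -/
private theorem one_lt_log_max {q : ℕ} (hq : 3 ≤ q) (t M₀ : ℝ) :
    1 < Real.log (max (max (q : ℝ) ((q : ℝ) * |t|)) M₀) := by
  have hq3 : (3 : ℝ) ≤ (q : ℝ) := by exact_mod_cast hq
  have hlog3 : 1 < Real.log 3 := by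
    have h := Real.exp_one_lt_d9
    rw [Real.lt_log_iff_exp_lt (by norm_num)]
    linarith
  refine lt_of_lt_of_le hlog3 (Real.log_le_log (by norm_num) ?_)
  exact hq3.trans ((le_max_left _ _).trans (le_max_left _ _))

/-- The threshold `1 − 1/(R log max(q, q|t|, M₀))` is monotone in `(R, M₀)`: for `0 < R ≤ R'` and
`M₀ ≤ M₀'` (and `q ≥ 3`), `1 − 1/(R log M) ≤ 1 − 1/(R' log M')`. [folklore] -/
private theorem threshold_mono {q : ℕ} (hq : 3 ≤ q) (t : ℝ) {R R' M₀ M₀' : ℝ} (hR : 0 < R)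
    (hRR : R ≤ R') (hMM : M₀ ≤ M₀') :
    1 - 1 / (R * Real.log (max (max (q : ℝ) ((q : ℝ) * |t|)) M₀)) ≤
      1 - 1 / (R' * Real.log (max (max (q : ℝ) ((q : ℝ) * |t|)) M₀')) := by
  have hL := one_lt_log_max hq t M₀
  have hL' := one_lt_log_max hq t M₀'
  have hpos3 : (0 : ℝ) < max (max (q : ℝ) ((q : ℝ) * |t|)) M₀ := by
    have hq3 : (3 : ℝ) ≤ (q : ℝ) := by exact_mod_cast hq
    linarith [le_max_left (max (q : ℝ) ((q : ℝ) * |t|)) M₀, le_max_left (q : ℝ) ((q : ℝ) * |t|)]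
  have hlogle : Real.log (max (max (q : ℝ) ((q : ℝ) * |t|)) M₀) ≤
      Real.log (max (max (q : ℝ) ((q : ℝ) * |t|)) M₀') :=
    Real.log_le_log hpos3 (max_le_max le_rfl hMM)
  have h1 : R * Real.log (max (max (q : ℝ) ((q : ℝ) * |t|)) M₀) ≤
      R' * Real.log (max (max (q : ℝ) ((q : ℝ) * |t|)) M₀') :=
    mul_le_mul hRR hlogle (by linarith) (by linarith)
  have h0 : 0 < R * Real.log (max (max (q : ℝ) ((q : ℝ) * |t|)) M₀) := mul_pos hR (by linarith)
  have := one_div_le_one_div_of_le h0 h1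
  linarith

namespace AtMostOneZeroInRegion

/-- **Monotonicity.** A larger constant `R₀' ≥ R₀ > 0` or floor `M₀' ≥ M₀` is a smaller region, so
`AtMostOneZeroInRegion R₀ M₀ → AtMostOneZeroInRegion R₀' M₀'`. [cite: McCurley1984ZFR, Theorem 1] -/
theorem mono {R₀ R₀' M₀ M₀' : ℝ} (h : AtMostOneZeroInRegion R₀ M₀) (hR : 0 < R₀) (hRR : R₀ ≤ R₀')
    (hMM : M₀ ≤ M₀') : AtMostOneZeroInRegion R₀' M₀' := by
  intro q _ hq χ₁ χ₂ s₁ s₂ h₁ h₂ hr₁ hr₂ hz₁ hz₂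
  exact h q hq χ₁ χ₂ s₁ s₂ h₁ h₂
    ((threshold_mono hq s₁.im hR hRR hMM).trans_lt hr₁)
    ((threshold_mono hq s₂.im hR hRR hMM).trans_lt hr₂) hz₁ hz₂

/-- A zero in the region is real and belongs to a quadratic non-principal character (the diagonal
case `(χ, s) = (χ, s)` of the statement). [cite: McCurley1984ZFR, Theorem 1] -/
theorem real_of_zero {R₀ M₀ : ℝ} (h : AtMostOneZeroInRegion R₀ M₀) {q : ℕ} [NeZero q] (hq : 3 ≤ q)
    (χ : DirichletCharacter ℂ q) {s : ℂ} (hs : s ≠ 1)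
    (hr : 1 - 1 / (R₀ * Real.log (max (max (q : ℝ) ((q : ℝ) * |s.im|)) M₀)) < s.re)
    (hz : χ.LFunction s = 0) : s.im = 0 ∧ χ ≠ 1 ∧ χ ^ 2 = 1 :=
  (h q hq χ χ s s hs hs hr hr hz hz).2

end AtMostOneZeroInRegion

/-- **Kadiri's `∃`-form fact in this vocabulary.** From the tree's named fact
`Kadiri2018.dirichlet_atMostOneZero` (`∃ R₀ ≥ 1`, CLOSED region `σ ≥ 1 − 1/(R₀ log max(q, q|t|))`,
`q ≥ 3`): `∃ R₀ ≥ 1, ∀ M₀ ≤ 3, AtMostOneZeroInRegion R₀ M₀` (for `M₀ ≤ 3 ≤ q` the floor is idle,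
and the open region lies in the closed one). [cite: Kadiri2018, Thm 1.1] -/
theorem atMostOneZeroInRegion_of_kadiri (h : Kadiri2018.dirichlet_atMostOneZero) :
    ∃ R₀ : ℝ, 1 ≤ R₀ ∧ ∀ M₀ : ℝ, M₀ ≤ 3 → AtMostOneZeroInRegion R₀ M₀ := by
  obtain ⟨R₀, hR₀, H⟩ := h
  refine ⟨R₀, hR₀, fun M₀ hM₀ q _ hq χ₁ χ₂ s₁ s₂ h₁ h₂ hr₁ hr₂ hz₁ hz₂ ↦
    H q hq χ₁ χ₂ s₁ s₂ h₁ h₂ ?_ ?_ hz₁ hz₂⟩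
  all_goals
    unfold Kadiri2018.InRegion
    have hq3 : (3 : ℝ) ≤ (q : ℝ) := by exact_mod_cast hq
  · have hmax : max (max (q : ℝ) ((q : ℝ) * |s₁.im|)) M₀ = max (q : ℝ) ((q : ℝ) * |s₁.im|) :=
      max_eq_left (hM₀.trans (hq3.trans (le_max_left _ _)))
    rw [hmax] at hr₁
    exact hr₁.le
  · have hmax : max (max (q : ℝ) ((q : ℝ) * |s₂.im|)) M₀ = max (q : ℝ) ((q : ℝ) * |s₂.im|) :=
      max_eq_left (hM₀.trans (hq3.trans (le_max_left _ _)))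
    rw [hmax] at hr₂
    exact hr₂.le

/-! ### The exception-free region up to a level -/

/-- **Zero-free region without exception up to level `Q`, constant `R`, floor `M₀`.** For every
modulus `3 ≤ q ≤ Q`, every Dirichlet character `χ` mod `q` (principal and imprimitive included)
and every `s ≠ 1` with `Re s > 1 − 1/(R log max(q, q|Im s|, M₀))`: `L(s, χ) ≠ 0`. This is what
McCurley's Theorem 1 yields for his "nonexceptional moduli", asserted for all `q ≤ Q` at once
(Bennett–Martin–O'Bryant–Rechnitzer's route to Proposition 6.18).
[cite: McCurley1984ZFR, Theorem 1 (nonexceptional moduli)] -/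
def ZeroFreeRegionUpTo (Q : ℕ) (R M₀ : ℝ) : Prop :=
  ∀ (q : ℕ) [NeZero q], 3 ≤ q → q ≤ Q → ∀ (χ : DirichletCharacter ℂ q) (s : ℂ), s ≠ 1 →
    1 - 1 / (R * Real.log (max (max (q : ℝ) ((q : ℝ) * |s.im|)) M₀)) < s.re → χ.LFunction s ≠ 0

namespace ZeroFreeRegionUpTo

variable {Q : ℕ} {R M₀ : ℝ}

/-- Antitone in the level. [cite: McCurley1984ZFR, Theorem 1 (nonexceptional moduli)] -/
theorem anti_level (h : ZeroFreeRegionUpTo Q R M₀) {Q' : ℕ} (hQ : Q' ≤ Q) :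
    ZeroFreeRegionUpTo Q' R M₀ :=
  fun q _ hq3 hqQ χ s hs hr ↦ h q hq3 (hqQ.trans hQ) χ s hs hr

/-- Monotone in `(R, M₀)`: a larger constant or floor is a smaller region.
[cite: McCurley1984ZFR, Theorem 1 (nonexceptional moduli)] -/
theorem mono (h : ZeroFreeRegionUpTo Q R M₀) (hR : 0 < R) {R' M₀' : ℝ} (hRR : R ≤ R')
    (hMM : M₀ ≤ M₀') : ZeroFreeRegionUpTo Q R' M₀' :=
  fun q _ hq3 hqQ χ s hs hr ↦ h q hq3 hqQ χ s hs ((threshold_mono hq3 s.im hR hRR hMM).trans_lt hr)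

end ZeroFreeRegionUpTo

/-- **Main theorem: the table removes the exception.** Let `AtMostOneZeroInRegion R₀ M₀` hold
(`R₀ > 0`) and let `NoExceptionalZeroUpTo Q c₀` hold. Then for every constant `R` with `R ≥ R₀`,
`R ≥ 1` and `R c₀ ≥ 1` (so `c₀ > 0`): `ZeroFreeRegionUpTo Q R M₀`. Proof: a zero `(χ, s)`, `s ≠ 1`,
`3 ≤ q ≤ Q`, in the `R`-region lies in the `R₀`-region (monotonicity), so `s = σ` is real and `χ`
is quadratic non-principal; at `t = 0` the region is `σ > 1 − 1/(R log max(q, M₀)) ≥ 1 − c₀/log q`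
(`log max(q, M₀) ≥ log q > 0`, `1/R ≤ c₀`), and `σ > 0` (`R log 3 ≥ log 3 > 1`); this contradicts
`NoExceptionalZeroUpTo.lfunction_ne_zero`. [cite: BennettMartinOBryantRechnitzer2018, Proposition 6.18] -/
theorem zeroFreeRegionUpTo_of_noExceptionalZeroUpTo {R₀ M₀ : ℝ} (hA : AtMostOneZeroInRegion R₀ M₀)
    (hR₀ : 0 < R₀) {Q : ℕ} {c₀ : ℝ} (hN : NoExceptionalZeroUpTo Q c₀) {R : ℝ}
    (hRR : R₀ ≤ R) (hR1 : 1 ≤ R) (hRc : 1 ≤ R * c₀) : ZeroFreeRegionUpTo Q R M₀ := by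
  intro q _ hq3 hqQ χ s hs hr hz
  have hq3r : (3 : ℝ) ≤ (q : ℝ) := by exact_mod_cast hq3
  -- the zero lies in the `R₀`-region: it is real and `χ` is quadratic non-principal
  have hr₀ : 1 - 1 / (R₀ * Real.log (max (max (q : ℝ) ((q : ℝ) * |s.im|)) M₀)) < s.re :=
    (threshold_mono hq3 s.im hR₀ hRR le_rfl).trans_lt hr
  obtain ⟨him, hne, hsq⟩ := hA.real_of_zero hq3 χ hs hr₀ hz
  have hquad : χ.IsQuadratic := MulChar.isQuadratic_iff_sq_eq_one.mpr hsq
  -- `s = σ` real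
  set σ : ℝ := s.re with hσdef
  have hsσ : s = (σ : ℂ) := Complex.ext (by simp [hσdef]) (by simp [him])
  -- the region at `t = 0`
  have hmax : max (max (q : ℝ) ((q : ℝ) * |s.im|)) M₀ = max (q : ℝ) M₀ := by
    rw [him, abs_zero, mul_zero, max_eq_left (by linarith : (0 : ℝ) ≤ q)]
  rw [hmax] at hr
  have hlogq : 1 < Real.log q := by
    have hlog3 : 1 < Real.log 3 := by
      have h := Real.exp_one_lt_d9
      rw [Real.lt_log_iff_exp_lt (by norm_num)]
      linarith
    exact lt_of_lt_of_le hlog3 (Real.log_le_log (by norm_num) hq3r)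
  have hlogM : Real.log q ≤ Real.log (max (q : ℝ) M₀) :=
    Real.log_le_log (by linarith) (le_max_left _ _)
  have hRlog : 0 < R * Real.log q := mul_pos (by linarith) (by linarith)
  -- `1/(R log max(q, M₀)) ≤ 1/(R log q) ≤ c₀/log q` and `≤ 1`
  have h1 : 1 / (R * Real.log (max (q : ℝ) M₀)) ≤ 1 / (R * Real.log q) :=
    one_div_le_one_div_of_le hRlog (mul_le_mul_of_nonneg_left hlogM (by linarith))
  have h2 : 1 / (R * Real.log q) ≤ c₀ / Real.log q := by
    rw [div_le_div_iff₀ hRlog (by linarith)]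
    nlinarith
  have h3 : 1 / (R * Real.log q) < 1 := by
    rw [div_lt_one hRlog]
    nlinarith
  have hσ0 : 0 < σ := by linarith
  have hσw : 1 - c₀ / Real.log q ≤ σ := by linarith
  have hzσ : χ.LFunction (σ : ℂ) = 0 := by rw [← hsσ]; exact hz
  exact hN.lfunction_ne_zero hqQ χ hquad hne hσ0 hσw hzσ

/-- **Converse bookkeeping** (Kadiri-type floor `M₀ ≤ 3`): a region `ZeroFreeRegionUpTo Q R M₀`
contains the real window of every constant `c < 1/R`, so `NoExceptionalZeroUpTo Q c`
(at `t = 0`, `max(q, 0, M₀) = q` and `1 − c/log q > 1 − 1/(R log q)`; at `σ = 1`, `L(1, χ) ≠ 0`).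
[cite: McCurley1984ZFR, Theorem 1 (nonexceptional moduli)] -/
theorem noExceptionalZeroUpTo_of_zeroFreeRegionUpTo {Q : ℕ} {R M₀ : ℝ} (h : ZeroFreeRegionUpTo Q R M₀)
    (hM : M₀ ≤ 3) {c : ℝ} (hc : c < 1 / R) : NoExceptionalZeroUpTo Q c := by
  intro q _ hq3 hqQ χ _ hprim σ _ hσ hσ1
  have hne : χ ≠ 1 := SiegelZeroQuality.ne_one_of_isPrimitive hprim (by omega)
  rcases eq_or_lt_of_le hσ1 with rfl | hlt
  · exact DirichletCharacter.LFunction_ne_zero_of_one_le_re χ (Or.inl hne) (by simp)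
  · have hq3r : (3 : ℝ) ≤ (q : ℝ) := by exact_mod_cast hq3
    have hlogq : 0 < Real.log q := Real.log_pos (by linarith)
    refine h q hq3 hqQ χ (σ : ℂ) ?_ ?_
    · intro h1
      have := congrArg Complex.re h1
      simp at this
      linarith
    · have hmax : max (max (q : ℝ) ((q : ℝ) * |((σ : ℂ)).im|)) M₀ = (q : ℝ) := by
        rw [Complex.ofReal_im, abs_zero, mul_zero, max_eq_left (by linarith : (0 : ℝ) ≤ q),
          max_eq_left (hM.trans hq3r)]
      rw [hmax, Complex.ofReal_re]
      have hlt' : c / Real.log q < 1 / R / Real.log q := div_lt_div_of_pos_right hc hlogq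
      have heq : 1 / R / Real.log q = 1 / (R * Real.log q) := by rw [div_div]
      linarith

/-- **`∃`-form through Kadiri.** From the tree's named fact `Kadiri2018.dirichlet_atMostOneZero`
and a table `NoExceptionalZeroUpTo Q c₀` (`c₀ > 0`): there is `R ≥ 1` with
`ZeroFreeRegionUpTo Q R 3` (region `σ > 1 − 1/(R log max(q, q|t|))`; `R = max(R₀, 1/c₀)`).
[cite: Kadiri2018, Thm 1.1] -/
theorem exists_zeroFreeRegionUpTo_of_kadiri (hK : Kadiri2018.dirichlet_atMostOneZero) {Q : ℕ}
    {c₀ : ℝ} (hN : NoExceptionalZeroUpTo Q c₀) (hc : 0 < c₀) :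
    ∃ R : ℝ, 1 ≤ R ∧ ZeroFreeRegionUpTo Q R 3 := by
  obtain ⟨R₀, hR₀, H⟩ := atMostOneZeroInRegion_of_kadiri hK
  refine ⟨max R₀ (1 / c₀), hR₀.trans (le_max_left _ _), ?_⟩
  refine zeroFreeRegionUpTo_of_noExceptionalZeroUpTo (H 3 le_rfl) (by linarith) hN
    (le_max_left _ _) (hR₀.trans (le_max_left _ _)) ?_
  have : 1 / c₀ * c₀ = 1 := by field_simp
  calc (1 : ℝ) = 1 / c₀ * c₀ := this.symm
    _ ≤ max R₀ (1 / c₀) * c₀ := mul_le_mul_of_nonneg_right (le_max_right _ _) hc.le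

/-- **Instance of record of the printed range** (conditional on two named facts: Platt's GRH
computation and McCurley's theorem): for every modulus `3 ≤ q ≤ 400 000`, every Dirichlet character
`χ` mod `q` and every `s ≠ 1` with `Re s > 1 − 1/(9.645908801 · log max(q, q|Im s|, 10))`,
`L(s, χ) ≠ 0` — McCurley's region holds WITHOUT exceptional zero throughout Platt's range
(`noExceptionalZeroUpTo_platt`: `c₀ = 1/2`, and `9.645908801 · (1/2) ≥ 1`).
[cite: BennettMartinOBryantRechnitzer2018, Definition 6.1 and Proposition 6.18] -/
theorem zeroFreeRegionUpTo_platt_mccurley (hP : platt2016_theorem71) (hM : McCurley1984_theorem1) :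
    ZeroFreeRegionUpTo 400000 9.645908801 10 :=
  zeroFreeRegionUpTo_of_noExceptionalZeroUpTo hM (by norm_num) (noExceptionalZeroUpTo_platt hP)
    le_rfl (by norm_num) (by norm_num)


/-! ### The converse bridge: an at-most-one-zero theorem with ANY constant and floor (in particular
McCurley's refereed all-`q` Theorem 1) implies the tree's `∃`-form Kadiri fact

Provenance note (ls-lit-r3 g2, F-S3 §C, 2026-08-26). The REFEREED paper H. Kadiri, *Explicit
zero-free regions for Dirichlet L-functions*, Mathematika 64 (2018) 445–474 proves a zero-free region
with `R = 5.60` for `3 ≤ q ≤ 400 000` ONLY — zbMATH review Zbl 1412.11096 (read 2026-08-26): "for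
every non-principle primitive Dirichlet character `χ` modulo `q` with `3 ≤ q ≤ 400 000`, the
Dirichlet `L`-function `L(s,χ)` has no zeros in the region `Re(s) ≥ 1 − 1/(R log(q max(1,|Im(s)|)))`
with `R = 5.60`. This improves the previous result (`R = 6.436`) of the author from her PhD thesis
[Lille 2001] and the result (`R = 9.646`) due to K. S. McCurley"; likewise Lu–Zaman–Zhao,
Math. Comp. (2026) = arXiv:2602.03626 p. 1 ("cf. Kadiri [Kad18] for improvements when
`q ⩽ 4×10⁵`"), Bordignon, JNT 201 (2019) = arXiv:1809.05226 p. 3, and Bennett–Martin–O'Bryant–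
Rechnitzer, Illinois J. Math. 62 (2018) Prop. 4.34. The all-`q` constant `6.4355` belongs to
Kadiri's Lille thesis (2002) and `6.3970` to the unrefereed preprint arXiv:math/0510570; the all-`q`
at-most-one-zero theorem OF REFEREED RECORD is McCurley 1984, Theorem 1 (`McCurley1984_theorem1`
above). The theorems below make the tree's `∃`-form fact `Kadiri2018.dirichlet_atMostOneZero` a
COROLLARY of McCurley's theorem (closed region with a LARGER existential constant inside the open
one), so that nothing rests on the thesis/preprint constants. -/

/-- Comparison of thresholds: for `R₀ > 0`, any floor `M₀`, `q ≥ 3` and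
`R' = 1 + R₀ + R₀ log max(M₀, 3)`, the CLOSED Kadiri-shaped region
`σ ≥ 1 − 1/(R' log max(q, q|t|))` lies inside the OPEN McCurley-shaped region
`σ > 1 − 1/(R₀ log max(q, q|t|, M₀))` (because `R₀ log max(M, M₀) ≤ R₀ (log M + log max(M₀,3))
< R' log M` for `M = max(q, q|t|) ≥ 3`, `log M > 1`). [folklore] -/
private theorem inRegion_transfer {R₀ M₀ : ℝ} (hR : 0 < R₀) {q : ℕ} (hq : 3 ≤ q) (s : ℂ)
    (hs : Kadiri2018.InRegion (1 + R₀ + R₀ * Real.log (max M₀ 3)) q s) :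
    1 - 1 / (R₀ * Real.log (max (max (q : ℝ) ((q : ℝ) * |s.im|)) M₀)) < s.re := by
  unfold Kadiri2018.InRegion at hs
  set M : ℝ := max (q : ℝ) ((q : ℝ) * |s.im|) with hM
  set L₃ : ℝ := Real.log (max M₀ 3) with hL₃
  have hq3 : (3 : ℝ) ≤ (q : ℝ) := by exact_mod_cast hq
  have hM3 : (3 : ℝ) ≤ M := hq3.trans (le_max_left _ _)
  have hMpos : 0 < M := by linarith
  have hlog3 : 1 < Real.log 3 := by
    have h := Real.exp_one_lt_d9
    rw [Real.lt_log_iff_exp_lt (by norm_num)]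
    linarith
  have hlogM : 1 < Real.log M := hlog3.trans_le (Real.log_le_log (by norm_num) hM3)
  have hlogM0 : 0 < Real.log M := one_pos.trans hlogM
  have hL₃nn : 0 ≤ L₃ :=
    Real.log_nonneg ((show (1 : ℝ) ≤ 3 by norm_num).trans (le_max_right _ _))
  have hlogM' : Real.log (max M M₀) ≤ Real.log M + L₃ := by
    rcases le_total M₀ M with h | h
    · rw [max_eq_left h]
      linarith
    · rw [max_eq_right h]
      have hM₀pos : 0 < M₀ := hMpos.trans_le h
      have hle : Real.log M₀ ≤ L₃ := Real.log_le_log hM₀pos (le_max_left _ _)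
      linarith
  have hlogM'pos : 0 < Real.log (max M M₀) :=
    hlogM0.trans_le (Real.log_le_log hMpos (le_max_left _ _))
  have hkey : R₀ * Real.log (max M M₀) < (1 + R₀ + R₀ * L₃) * Real.log M := by
    have h1 : R₀ * Real.log (max M M₀) ≤ R₀ * Real.log M + R₀ * L₃ := by
      have := mul_le_mul_of_nonneg_left hlogM' hR.le
      linarith
    have h2 : R₀ * L₃ ≤ R₀ * L₃ * Real.log M := by
      have h0 : 0 ≤ R₀ * L₃ := mul_nonneg hR.le hL₃nn
      nlinarith
    nlinarith
  have hA : 0 < R₀ * Real.log (max M M₀) := mul_pos hR hlogM'pos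
  have hdiv : 1 / ((1 + R₀ + R₀ * L₃) * Real.log M) < 1 / (R₀ * Real.log (max M M₀)) :=
    one_div_lt_one_div_of_lt hA hkey
  linarith

/-- **Any at-most-one-zero theorem implies the tree's `∃`-form Kadiri fact.** For `R₀ > 0` and any
floor `M₀`: `AtMostOneZeroInRegion R₀ M₀ → Kadiri2018.dirichlet_atMostOneZero`, with the witness
`R' = 1 + R₀ + R₀ log max(M₀, 3) ≥ 1` (McCurley's open region `σ > 1 − 1/(R log max(k, k|t|, 10))`
versus the closed `∃ R₀` region of the Kadiri-shaped fact).
[cite: McCurley1984ZFR, Theorem 1] [cite: Kadiri2018, Thm 1.1] -/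
theorem Kadiri2018.dirichlet_atMostOneZero_of_atMostOneZeroInRegion {R₀ M₀ : ℝ} (hR : 0 < R₀)
    (h : AtMostOneZeroInRegion R₀ M₀) : Kadiri2018.dirichlet_atMostOneZero := by
  refine ⟨1 + R₀ + R₀ * Real.log (max M₀ 3), ?_, ?_⟩
  · have h0 : 0 ≤ R₀ * Real.log (max M₀ 3) :=
      mul_nonneg hR.le (Real.log_nonneg ((show (1 : ℝ) ≤ 3 by norm_num).trans (le_max_right _ _)))
    linarith
  · intro q _ hq χ₁ χ₂ s₁ s₂ h₁ h₂ hr₁ hr₂ hz₁ hz₂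
    exact h q hq χ₁ χ₂ s₁ s₂ h₁ h₂ (inRegion_transfer hR hq s₁ hr₁) (inRegion_transfer hR hq s₂ hr₂)
      hz₁ hz₂

/-- **McCurley 1984, Theorem 1 ⇒ the tree's `∃`-form Kadiri fact** (`R₀ = 9.645908801`, `M₀ = 10`;
witness `R' = 1 + R₀ + R₀ log 10`). This is the provenance of refereed record for
`Kadiri2018.dirichlet_atMostOneZero` for ALL moduli `q ≥ 3` (Kadiri, Mathematika 2018, covers
`q ≤ 4·10⁵` only; see the section note). [cite: McCurley1984ZFR, Theorem 1] -/
theorem Kadiri2018.dirichlet_atMostOneZero_of_mccurley (h : McCurley1984_theorem1) :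
    Kadiri2018.dirichlet_atMostOneZero :=
  Kadiri2018.dirichlet_atMostOneZero_of_atMostOneZeroInRegion (by norm_num) h


/-! ### McCurley's Theorem 1 AS PRINTED: the CLOSED region `σ ⩾ 1 − 1/(R log M)`

Added 2026-08-28 (littype-FP2-1 g17) after the page image of J. Number Theory 19 (1984) p. 8 was
rendered from the held scan (the OCR layer prints `>`; the image prints `⩾`; see the module
docstring). The closed-region statement is STRONGER than the open-region rendering
`McCurley1984_theorem1` above (a closed region contains the open one with the same constant), and it
is the form in which the theorem is quoted downstream — Kadiri, Mathematika 64 (2018) Thm 2.2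
("`𝔏_q(s)` has at most a single zero in the region `{s : Re s ≥ 1 − 1/(R log M)}`") and
Thorner–Zaman, Forum Math. 36 (2024) Lemma 2.3 — in particular it is what Thorner–Zaman's
Theorem 2.6 (first assertion; tree `thornerZaman2024_theorem26a`, strict `<` in its conclusion) needs
on the boundary. Everything else (pairs `(χ, s)` with `s ≠ 1`, moduli `q ≥ 3`, simplicity not
rendered) follows the conventions of `AtMostOneZeroInRegion`. -/

/-- **At most one zero of `∏_{χ mod q} L(s, χ)` in the CLOSED region
`σ ⩾ 1 − 1/(R₀ log max(q, q|t|, M₀))`, real and from a real non-principal character** — the shape of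
McCurley's Theorem 1 exactly as displayed on p. 8 (`R₀ = 9.645908801`, `M₀ = 10`), for all moduli
`q ≥ 3`, rendered on pairs as in `AtMostOneZeroInRegion` (two zeros `(χ₁, s₁)`, `(χ₂, s₂)` in the
closed region, `sᵢ ≠ 1`, coincide as pairs; the zero is real; `χ₁ ≠ χ₀`, `χ₁² = χ₀`). Simplicity of
the zero is not rendered. [cite: McCurley1984ZFR, Theorem 1] -/
def AtMostOneZeroInClosedRegion (R₀ M₀ : ℝ) : Prop :=
  ∀ (q : ℕ) [NeZero q], 3 ≤ q →
    ∀ (χ₁ χ₂ : DirichletCharacter ℂ q) (s₁ s₂ : ℂ), s₁ ≠ 1 → s₂ ≠ 1 →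
      1 - 1 / (R₀ * Real.log (max (max (q : ℝ) ((q : ℝ) * |s₁.im|)) M₀)) ≤ s₁.re →
      1 - 1 / (R₀ * Real.log (max (max (q : ℝ) ((q : ℝ) * |s₂.im|)) M₀)) ≤ s₂.re →
      χ₁.LFunction s₁ = 0 → χ₂.LFunction s₂ = 0 →
      (χ₁ = χ₂ ∧ s₁ = s₂) ∧ s₁.im = 0 ∧ χ₁ ≠ 1 ∧ χ₁ ^ 2 = 1

/-- **McCurley 1984, Theorem 1, AS PRINTED (J. Number Theory 19 (1984), p. 8; page image checked
2026-08-28): "Let `M = max{k, k|t|, 10}` and `R = 9.645908801`. Then `𝓛_k(s)` has at most a single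
zero in the region `{s : σ ⩾ 1 − 1/(R log M)}`. The only possible zero in this region is a simple
real zero arising from an L-function formed with a real non-principal character modulo `k`."**
(`𝓛_k(s) = ∏_{χ mod k} L(s, χ)`, op. cit. (1).) Rendered as `AtMostOneZeroInClosedRegion 9.645908801 10`
— the CLOSED region of the print; moduli `k ≥ 3` (for `k = 1, 2` the statement concerns `ζ` alone),
pairs `(χ, s)` with `s ≠ 1` (Mathlib's junk value of the principal `L`-function at its pole kept out),
simplicity dropped (weaker than print in that respect only). Restated with the closed region by
Kadiri, Mathematika 64 (2018) Thm 2.2, and Thorner–Zaman, Forum Math. 36 (2024) Lemma 2.3. Implies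
the tree's open-region `McCurley1984_theorem1` (`McCurley1984_theorem1_of_closed`). Proof in print:
de la Vallée-Poussin's method with Stechkin's device and Rosser–Schoenfeld's constant, 26 pp. of
explicit estimates; not discharged here (size L). [cite: McCurley1984ZFR, Theorem 1] -/
def McCurley1984_theorem1_closed : Prop :=
  AtMostOneZeroInClosedRegion 9.645908801 10

namespace AtMostOneZeroInClosedRegion

/-- **The closed region contains the open one**: `AtMostOneZeroInClosedRegion R₀ M₀ →
AtMostOneZeroInRegion R₀ M₀` (same constant and floor). [cite: McCurley1984ZFR, Theorem 1] -/
theorem toOpen {R₀ M₀ : ℝ} (h : AtMostOneZeroInClosedRegion R₀ M₀) : AtMostOneZeroInRegion R₀ M₀ :=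
  fun q _ hq χ₁ χ₂ s₁ s₂ h₁ h₂ hr₁ hr₂ hz₁ hz₂ ↦ h q hq χ₁ χ₂ s₁ s₂ h₁ h₂ hr₁.le hr₂.le hz₁ hz₂

/-- **Monotonicity.** A larger constant `R₀' ≥ R₀ > 0` or floor `M₀' ≥ M₀` is a smaller closed
region, so `AtMostOneZeroInClosedRegion R₀ M₀ → AtMostOneZeroInClosedRegion R₀' M₀'`.
[cite: McCurley1984ZFR, Theorem 1] -/
theorem mono {R₀ R₀' M₀ M₀' : ℝ} (h : AtMostOneZeroInClosedRegion R₀ M₀) (hR : 0 < R₀)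
    (hRR : R₀ ≤ R₀') (hMM : M₀ ≤ M₀') : AtMostOneZeroInClosedRegion R₀' M₀' := by
  intro q _ hq χ₁ χ₂ s₁ s₂ h₁ h₂ hr₁ hr₂ hz₁ hz₂
  exact h q hq χ₁ χ₂ s₁ s₂ h₁ h₂
    ((threshold_mono hq s₁.im hR hRR hMM).trans hr₁)
    ((threshold_mono hq s₂.im hR hRR hMM).trans hr₂) hz₁ hz₂

/-- A zero in the closed region is real and belongs to a quadratic non-principal character (the
diagonal case of the statement). [cite: McCurley1984ZFR, Theorem 1] -/
theorem real_of_zero {R₀ M₀ : ℝ} (h : AtMostOneZeroInClosedRegion R₀ M₀) {q : ℕ} [NeZero q]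
    (hq : 3 ≤ q) (χ : DirichletCharacter ℂ q) {s : ℂ} (hs : s ≠ 1)
    (hr : 1 - 1 / (R₀ * Real.log (max (max (q : ℝ) ((q : ℝ) * |s.im|)) M₀)) ≤ s.re)
    (hz : χ.LFunction s = 0) : s.im = 0 ∧ χ ≠ 1 ∧ χ ^ 2 = 1 :=
  (h q hq χ χ s s hs hs hr hr hz hz).2

/-- **No zero ON OR ABOVE the threshold other than the one real exceptional zero**: if `(χ₁, β₁)`
(`β₁` real, `L(β₁, χ₁) = 0`, `β₁` in the closed window at `t = 0`) is a zero in the closed region,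
then every zero `(χ, s)`, `s ≠ 1`, in the closed region of the same modulus is `(χ₁, β₁)`.
[cite: McCurley1984ZFR, Theorem 1] -/
theorem eq_of_zero {R₀ M₀ : ℝ} (h : AtMostOneZeroInClosedRegion R₀ M₀) {q : ℕ} [NeZero q]
    (hq : 3 ≤ q) {χ₁ : DirichletCharacter ℂ q} {β₁ : ℝ} (hβ1 : β₁ ≠ 1)
    (hrβ : 1 - 1 / (R₀ * Real.log (max (q : ℝ) M₀)) ≤ β₁) (hzβ : χ₁.LFunction β₁ = 0)
    (χ : DirichletCharacter ℂ q) {s : ℂ} (hs : s ≠ 1)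
    (hr : 1 - 1 / (R₀ * Real.log (max (max (q : ℝ) ((q : ℝ) * |s.im|)) M₀)) ≤ s.re)
    (hz : χ.LFunction s = 0) : χ = χ₁ ∧ s = (β₁ : ℂ) := by
  have hβ1' : (β₁ : ℂ) ≠ 1 := fun h1 ↦ hβ1 (by exact_mod_cast h1)
  have hrβ' : 1 - 1 / (R₀ * Real.log (max (max (q : ℝ) ((q : ℝ) * |((β₁ : ℂ)).im|)) M₀)) ≤
      ((β₁ : ℂ)).re := by
    have hq0 : (0 : ℝ) ≤ (q : ℝ) := by positivity
    rw [Complex.ofReal_im, abs_zero, mul_zero, max_eq_left hq0, Complex.ofReal_re]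
    exact hrβ
  exact (h q hq χ χ₁ s (β₁ : ℂ) hs hβ1' hr hrβ' hz hzβ).1

end AtMostOneZeroInClosedRegion

/-- **McCurley's Theorem 1 as printed implies its open-region rendering** (so every consumer of
`McCurley1984_theorem1` is served by the printed statement). [cite: McCurley1984ZFR, Theorem 1] -/
theorem McCurley1984_theorem1_of_closed (h : McCurley1984_theorem1_closed) : McCurley1984_theorem1 :=
  AtMostOneZeroInClosedRegion.toOpen h

/-- The instance of record of the printed range from the statement AS PRINTED:
`platt2016_theorem71 → McCurley1984_theorem1_closed → ZeroFreeRegionUpTo 400000 9.645908801 10`.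
[cite: BennettMartinOBryantRechnitzer2018, Definition 6.1 and Proposition 6.18] -/
theorem zeroFreeRegionUpTo_platt_mccurleyClosed (hP : platt2016_theorem71)
    (hM : McCurley1984_theorem1_closed) : ZeroFreeRegionUpTo 400000 9.645908801 10 :=
  zeroFreeRegionUpTo_platt_mccurley hP (McCurley1984_theorem1_of_closed hM)

/-- McCurley's theorem AS PRINTED ⇒ the tree's `∃`-form Kadiri fact (through the open form).
[cite: McCurley1984ZFR, Theorem 1] -/
theorem Kadiri2018.dirichlet_atMostOneZero_of_mccurleyClosed (h : McCurley1984_theorem1_closed) :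
    Kadiri2018.dirichlet_atMostOneZero :=
  Kadiri2018.dirichlet_atMostOneZero_of_mccurley (McCurley1984_theorem1_of_closed h)

end Literature.NumberTheory.LFunctions

end
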